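import Summits.QuantumFields.YangMills.Theorems.UnitScaleTiltProp7BoxChartTransport
import Summits.QuantumFields.YangMills.Theorems.UnitScaleTiltProp7CurrentFieldCurlSum
import HarnessLib

/-!
# Route `UnitScaleTilt`, crux K1 «MinimiserStabilityRegPr» (stmt-QuantumFields-19200), LANE II «DIVERGENCE RECOVERY AT CURVED `W`» (★★OWNER RULING №23), ★p1 g19 NAMER WORD №13 [I-4]
# row `h4`, part 3 (the reading of its two functionals): **THE CHART-BOX INSIDE CURL OF (h4) IS AT MOST TWICE THE MEMBER's `CURL_HS` OVER ANY SITE SET CONTAINING THE CHART IMAGE;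
# ITS INSIDE MASS IS AT MOST THE FROBENIUS BOND SUM OVER ANY BOND SET CONTAINING THE CHART BONDS (`≤ ‖y‖²` over all bonds)**

Cell `ym3-torus`, width seat `ym-ust-19200-w4` (gen 11).  THEOREMS ONLY (0 `def`, 0 `sorry`); `--supports stmt-QuantumFields-19200 --as helper`, count-neutral.  YM₃ on T³ is a ladder rung
(R3), not d = 4, not the Clay problem; nothing here claims a stub, the crux or the gap.

THE POINT.  Row (h4) of ✓`Prop7BoxLocalResidualMember.boxLocalResidual_member` (part 2) prices `‖r‖²` by the (B1′) curl token of the pull-back `y_Z w μ := (toL2)⁻¹ y ⟨transl c w, μ⟩` —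
ALL ordered pairs `(μ, ν)`, indicator `[w + e_μ + e_ν ∈ Q_R(z)]`, Frobenius entries — while ★p1's `hPatch` letter `Cu_c` is the member's Hilbert–Schmidt curl `Σ_{x ∈ Ω} Σ_{μ<ν} Σ_jk ‖curl_W(μ,ν,x) j k‖²`
over a patch `Ω` of torus sites (the summand of ✓`Prop7EngOfTrueAvgBudget.curlHS_le_re_inner_DeltaEtaSlot`).  At a chart point the two curl letters AGREE (✓`Prop7BoxChartTransport.curl_transl`),
the curl is antisymmetric with zero diagonal (lit ✓`B9Eq39Adjoint.curl_swap`∕`curl_self`, so all pairs = twice `μ < ν`, ✓`Prop7CurrentFieldCurlSum.sum_sum_eq_two_mul_sum_lt`), the indicator only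
drops nonnegative terms, and the chart is injective on the box (✓`transl_injOn_box`, `2R + 1 ≤ N`): hence
`Σ_{w∈Q_R}Σ_μΣ_ν[w+e_μ+e_ν ∈ Q_R]‖curl y_Z‖_F² ≤ 2·Σ_{x∈S}Σ_{μ<ν}‖curl_W X (μ,ν,x)‖_F²` for every finite `S ⊇ transl c '' Q_R(z)` — ★p1's one-line monotonicity, typed once.
* §1 `sum_box_ite_curl_le_two_mul_sum` (generic `N`, bond function `X`, transport `U κ x`); §2 `sum_box_ite_frob_le_sum_on` (the mass twin: box inside mass ≤ Frobenius bond sum over any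
  `T ⊇` chart bonds); §3 ★`box_curlF_le_two_mul_curlHS_on`, ★`box_massF_le_sum_on`, ★`box_massF_le_norm_sq` (the member corollaries in (h4)'s exact letters: `V w μ = W♮⟨transl c w, μ⟩`,
  `(toL2 F K c₀).symm y`, prefactor `c₀`; the last: `≤ ‖y‖²`).
HONEST SCOPE.  Finite reindexing; no analysis; nothing of `hPatch`∕(REC)∕hN06∕the crux is proved here.

References: T. Bałaban, CMP 99 (1985) 389–434 [Balaban1985BackgroundPropagators] ((3.10) p.392, (3.100) p.413).
-/

set_option autoImplicit false

noncomputable section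

open scoped BigOperators Matrix.Norms.L2Operator
open Finset

namespace Summit.QuantumFields.YangMills.Theorems.Prop7BoxLocalResidualCurlReading

open Literature.MathematicalPhysics.QuantumFieldTheory.Balaban1983to89
open Literature.MathematicalPhysics.QuantumFieldTheory.Balaban1983to89.T3ContinuumYM3Torus
open Literature.MathematicalPhysics.QuantumFieldTheory.Balaban1983to89.B4Eq19LatticeOperators (Zd box mem_box unitVec)
open B10Eq27TorusAxialLog (transl unitsField toUField)
open B9TorusCalculus (torusT)
open B9Eq39Adjoint (curl curl_swap curl_self)
open B7Eq78Linearization (conjR)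
open B11Eq103H1Complex (BondL2K)
open Summit.QuantumFields.YangMills.Theorems.Prop7SectET3Transport (periodsT3)
open Summit.QuantumFields.YangMills.Theorems.Prop7SectET3HilbertLetters (W₂ frobEquiv toL2)
open Summit.QuantumFields.YangMills.Theorems.Prop7DeltaEtaAlmostPositive (norm_toL2_sq)
open Summit.QuantumFields.YangMills.Theorems.Prop7RieszTauFrobNorm (norm_sq_frobEquiv_symm)
open Summit.QuantumFields.YangMills.Theorems.Prop7BoxChartTransport (curl_transl transl_injOn_box)
open Summit.QuantumFields.YangMills.Theorems.Prop7CurrentFieldCurlSum (sum_sum_eq_two_mul_sum_lt)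

variable {P : Params} {j : ℕ} {N : ℕ}

/-! ## §1 The box inside curl is dominated by the Hilbert–Schmidt curl over any site set containing the chart image -/

/-- **THE BOX INSIDE CURL (all ordered pairs, chart letters) IS AT MOST TWICE THE HILBERT–SCHMIDT CURL OVER ANY SITE SET CONTAINING THE CHART IMAGE** (`2R + 1 ≤ N`; transport `U`,
bond function `X`; at a chart point the (B1′) curl token IS `curl (torusT) U X μ ν (transl c w)`). [cite: Balaban1985BackgroundPropagators, (3.10) p.392, (3.100) p.413] -/
theorem sum_box_ite_curl_le_two_mul_sum (c : Site P j) {z : Zd P.d} {R : ℤ} (hR : 2 * R + 1 ≤ (P.sitesPerDir j : ℤ))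
    (U : Fin P.d → Site P j → (Matrix (Fin N) (Fin N) ℂ)ˣ) (X : Fin P.d → Site P j → Matrix (Fin N) (Fin N) ℂ)
    (S : Finset (Site P j)) (hS : ∀ w ∈ box z R, transl c w ∈ S) :
    ∑ w ∈ box z R, ∑ μ, ∑ ν, (if w + unitVec μ + unitVec ν ∈ box z R then
        ∑ a : Fin N, ∑ b : Fin N, ‖(X μ (transl c w) + conjR (U μ (transl c w)) (X ν (transl c (w + unitVec μ)))
          - conjR (U ν (transl c w)) (X μ (transl c (w + unitVec ν))) - X ν (transl c w)) a b‖ ^ 2 else 0)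
      ≤ 2 * ∑ x ∈ S, ∑ μ, ∑ ν, (if μ < ν then ∑ a : Fin N, ∑ b : Fin N, ‖(curl (torusT P j) U X μ ν x) a b‖ ^ 2 else 0) := by
  classical
  -- drop the indicator and read the chart curl as the torus curl at the chart point
  have h1 : ∀ w ∈ box z R, ∑ μ, ∑ ν, (if w + unitVec μ + unitVec ν ∈ box z R then
        ∑ a : Fin N, ∑ b : Fin N, ‖(X μ (transl c w) + conjR (U μ (transl c w)) (X ν (transl c (w + unitVec μ)))
          - conjR (U ν (transl c w)) (X μ (transl c (w + unitVec ν))) - X ν (transl c w)) a b‖ ^ 2 else 0)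
      ≤ ∑ μ, ∑ ν, ∑ a : Fin N, ∑ b : Fin N, ‖(curl (torusT P j) U X μ ν (transl c w)) a b‖ ^ 2 := by
    intro w _
    refine Finset.sum_le_sum fun μ _ => Finset.sum_le_sum fun ν _ => ?_
    rw [curl_transl]
    split_ifs
    · exact le_rfl
    · positivity
  -- all ordered pairs = twice `μ < ν`
  have h2 : ∀ w : Zd P.d, ∑ μ, ∑ ν, ∑ a : Fin N, ∑ b : Fin N, ‖(curl (torusT P j) U X μ ν (transl c w)) a b‖ ^ 2
      = 2 * ∑ μ, ∑ ν, (if μ < ν then ∑ a : Fin N, ∑ b : Fin N, ‖(curl (torusT P j) U X μ ν (transl c w)) a b‖ ^ 2 else 0) := by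
    intro w
    refine sum_sum_eq_two_mul_sum_lt (P := P) (fun μ ν => ∑ a : Fin N, ∑ b : Fin N, ‖(curl (torusT P j) U X μ ν (transl c w)) a b‖ ^ 2) ?_ ?_
    · intro μ ν
      rw [curl_swap]
      simp only [Matrix.neg_apply, norm_neg]
    · intro μ
      simp only [curl_self, Matrix.zero_apply, norm_zero, ne_eq, OfNat.ofNat_ne_zero, not_false_eq_true, zero_pow, Finset.sum_const_zero]
  -- the chart is injective on the box and its image lies in `S`
  have h3 : ∑ w ∈ box z R, ∑ μ, ∑ ν, (if μ < ν then ∑ a : Fin N, ∑ b : Fin N, ‖(curl (torusT P j) U X μ ν (transl c w)) a b‖ ^ 2 else 0)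
      ≤ ∑ x ∈ S, ∑ μ, ∑ ν, (if μ < ν then ∑ a : Fin N, ∑ b : Fin N, ‖(curl (torusT P j) U X μ ν x) a b‖ ^ 2 else 0) := by
    rw [← Finset.sum_image (f := fun x => ∑ μ, ∑ ν, (if μ < ν then ∑ a : Fin N, ∑ b : Fin N, ‖(curl (torusT P j) U X μ ν x) a b‖ ^ 2 else 0))
      (transl_injOn_box c hR)]
    refine Finset.sum_le_sum_of_subset_of_nonneg (fun x hx => ?_) (fun x _ _ => ?_)
    · rw [Finset.mem_image] at hx
      obtain ⟨w, hw, rfl⟩ := hx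
      exact hS w hw
    · refine Finset.sum_nonneg fun μ _ => Finset.sum_nonneg fun ν _ => ?_
      split_ifs <;> positivity
  calc ∑ w ∈ box z R, ∑ μ, ∑ ν, (if w + unitVec μ + unitVec ν ∈ box z R then
        ∑ a : Fin N, ∑ b : Fin N, ‖(X μ (transl c w) + conjR (U μ (transl c w)) (X ν (transl c (w + unitVec μ)))
          - conjR (U ν (transl c w)) (X μ (transl c (w + unitVec ν))) - X ν (transl c w)) a b‖ ^ 2 else 0)
      ≤ ∑ w ∈ box z R, ∑ μ, ∑ ν, ∑ a : Fin N, ∑ b : Fin N, ‖(curl (torusT P j) U X μ ν (transl c w)) a b‖ ^ 2 := Finset.sum_le_sum h1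
    _ = ∑ w ∈ box z R, 2 * ∑ μ, ∑ ν, (if μ < ν then ∑ a : Fin N, ∑ b : Fin N, ‖(curl (torusT P j) U X μ ν (transl c w)) a b‖ ^ 2 else 0) :=
        Finset.sum_congr rfl fun w _ => h2 w
    _ = 2 * ∑ w ∈ box z R, ∑ μ, ∑ ν, (if μ < ν then ∑ a : Fin N, ∑ b : Fin N, ‖(curl (torusT P j) U X μ ν (transl c w)) a b‖ ^ 2 else 0) := by
        rw [Finset.mul_sum]
    _ ≤ 2 * ∑ x ∈ S, ∑ μ, ∑ ν, (if μ < ν then ∑ a : Fin N, ∑ b : Fin N, ‖(curl (torusT P j) U X μ ν x) a b‖ ^ 2 else 0) :=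
        mul_le_mul_of_nonneg_left h3 (by norm_num)

/-! ## §2 The mass twin: the box inside mass is dominated by the Frobenius bond sum over any bond set containing the chart bonds -/

/-- **THE BOX INSIDE MASS (chart letters) IS AT MOST THE FROBENIUS BOND SUM OVER ANY BOND SET CONTAINING THE CHART BONDS** (`2R + 1 ≤ N`; the map `(w, μ) ↦ ⟨transl c w, μ⟩` is
injective on `Q_R(z) × Fin d`; the indicator only drops nonnegative terms). [cite: Balaban1985BackgroundPropagators, (3.11) p.392, (3.100) p.413] -/
theorem sum_box_ite_frob_le_sum_on (c : Site P j) {z : Zd P.d} {R : ℤ} (hR : 2 * R + 1 ≤ (P.sitesPerDir j : ℤ))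
    (X : PBond P j → Matrix (Fin N) (Fin N) ℂ) (T : Finset (PBond P j)) (hT : ∀ w ∈ box z R, ∀ μ : Fin P.d, (⟨transl c w, μ⟩ : PBond P j) ∈ T) :
    ∑ w ∈ box z R, ∑ μ, (if w + unitVec μ ∈ box z R then ∑ a : Fin N, ∑ b : Fin N, ‖(X ⟨transl c w, μ⟩) a b‖ ^ 2 else 0)
      ≤ ∑ e ∈ T, ∑ a : Fin N, ∑ b : Fin N, ‖(X e) a b‖ ^ 2 := by
  classical
  have hinj : Set.InjOn (fun p : Zd P.d × Fin P.d => (⟨transl c p.1, p.2⟩ : PBond P j)) ↑(box z R ×ˢ (Finset.univ : Finset (Fin P.d))) := by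
    intro p hp p' hp' h
    rw [Finset.coe_product, Set.mem_prod] at hp hp'
    have hs : transl c p.1 = transl c p'.1 := congrArg PBond.src h
    have hd : p.2 = p'.2 := congrArg PBond.dir h
    exact Prod.ext (transl_injOn_box c hR hp.1 hp'.1 hs) hd
  calc ∑ w ∈ box z R, ∑ μ, (if w + unitVec μ ∈ box z R then ∑ a : Fin N, ∑ b : Fin N, ‖(X ⟨transl c w, μ⟩) a b‖ ^ 2 else 0)
      ≤ ∑ w ∈ box z R, ∑ μ, ∑ a : Fin N, ∑ b : Fin N, ‖(X ⟨transl c w, μ⟩) a b‖ ^ 2 := by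
        refine Finset.sum_le_sum fun w _ => Finset.sum_le_sum fun μ _ => ?_
        split_ifs
        · exact le_rfl
        · positivity
    _ = ∑ p ∈ box z R ×ˢ (Finset.univ : Finset (Fin P.d)), ∑ a : Fin N, ∑ b : Fin N, ‖(X ⟨transl c p.1, p.2⟩) a b‖ ^ 2 := by
        rw [Finset.sum_product]
    _ = ∑ e ∈ (box z R ×ˢ (Finset.univ : Finset (Fin P.d))).image (fun p : Zd P.d × Fin P.d => (⟨transl c p.1, p.2⟩ : PBond P j)),
          ∑ a : Fin N, ∑ b : Fin N, ‖(X e) a b‖ ^ 2 := by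
        rw [Finset.sum_image hinj]
    _ ≤ ∑ e ∈ T, ∑ a : Fin N, ∑ b : Fin N, ‖(X e) a b‖ ^ 2 := by
        refine Finset.sum_le_sum_of_subset_of_nonneg (fun e he => ?_) (fun e _ _ => by positivity)
        rw [Finset.mem_image] at he
        obtain ⟨p, hp, rfl⟩ := he
        rw [Finset.mem_product] at hp
        exact hT p.1 hp.1 p.2

/-! ## §3 The member corollaries in (h4)'s letters -/

section Member

open Literature.MathematicalPhysics.QuantumFieldTheory.Balaban1983to89.T3ContinuumYM3Torus

variable (F : T3Family) (K : ℕ) (c₀ : ℝ) [Fact (0 < c₀)]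

/-- ★ **(h4)'s CURL FUNCTIONAL ≤ 2 × THE MEMBER's `CURL_HS` OVER ANY SITE SET `S ⊇ transl c '' Q_R(z)`**: with `V w μ = W♮⟨transl c w, μ⟩` and `y_Z w μ = (toL2)⁻¹ y ⟨transl c w, μ⟩`,
`c₀·Σ_{w∈Q_R}Σ_μΣ_ν[w+e_μ+e_ν ∈ Q_R]‖y_Z w μ + R(V w μ)y_Z(w+e_μ) ν − R(V w ν)y_Z(w+e_ν) μ − y_Z w ν‖_F² ≤ 2·(c₀·Σ_{x∈S}Σ_μΣ_ν[μ<ν]‖curl_W((toL2)⁻¹y)(μ,ν,x)‖_F²)` — the summand of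
★p1's `Cu_c` ∕ of ✓`curlHS_le_re_inner_DeltaEtaSlot`. [cite: Balaban1985BackgroundPropagators, (3.10) p.392, (3.100) p.413] -/
theorem box_curlF_le_two_mul_curlHS_on (W : GaugeField (F.P K) 0 (Matrix.specialUnitaryGroup (Fin 2) ℂ))
    (c : Site (F.P K) 0) {z : Zd (F.P K).d} {R : ℤ} (hRN : 2 * R + 1 ≤ ((F.P K).sitesPerDir 0 : ℤ))
    (V : Zd (F.P K).d → Fin (F.P K).d → (Matrix (Fin 2) (Fin 2) ℂ)ˣ) (hV : ∀ w μ, V w μ = unitsField (toUField W) ⟨transl c w, μ⟩)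
    (y : BondL2K ℂ 3 (periodsT3 F K) c₀ W₂) (S : Finset (Site (F.P K) 0)) (hS : ∀ w ∈ box z R, transl c w ∈ S) :
    c₀ * ∑ w ∈ box z R, ∑ μ, ∑ ν, (if w + unitVec μ + unitVec ν ∈ box z R then
        ∑ j : Fin 2, ∑ k : Fin 2, ‖((toL2 F K c₀).symm y ⟨transl c w, μ⟩
          + conjR (V w μ) ((toL2 F K c₀).symm y ⟨transl c (w + unitVec μ), ν⟩)
          - conjR (V w ν) ((toL2 F K c₀).symm y ⟨transl c (w + unitVec ν), μ⟩)
          - (toL2 F K c₀).symm y ⟨transl c w, ν⟩) j k‖ ^ 2 else 0)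
      ≤ 2 * (c₀ * ∑ x ∈ S, ∑ μ : Fin (F.P K).d, ∑ ν : Fin (F.P K).d, (if μ < ν then ∑ j : Fin 2, ∑ k : Fin 2,
          ‖(curl (torusT (F.P K) 0) (fun κ w => unitsField (toUField W) ⟨w, κ⟩) (fun κ w => (toL2 F K c₀).symm y ⟨w, κ⟩) μ ν x) j k‖ ^ 2 else 0)) := by
  have hc₀ : 0 < c₀ := Fact.out
  have h := sum_box_ite_curl_le_two_mul_sum c hRN (fun κ w => unitsField (toUField W) ⟨w, κ⟩) (fun κ w => (toL2 F K c₀).symm y ⟨w, κ⟩) S hS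
  simp only [← hV] at h
  have h' := mul_le_mul_of_nonneg_left h hc₀.le
  linarith

/-- ★ **(h4)'s MASS FUNCTIONAL ≤ THE FROBENIUS BOND SUM OVER ANY BOND SET `T` CONTAINING THE CHART BONDS** (= (h1)'s left side; ★p1's `N_c` by set monotonicity).
[cite: Balaban1985BackgroundPropagators, (3.11) p.392, (3.100) p.413] -/
theorem box_massF_le_sum_on (c : Site (F.P K) 0) {z : Zd (F.P K).d} {R : ℤ} (hRN : 2 * R + 1 ≤ ((F.P K).sitesPerDir 0 : ℤ))
    (y : BondL2K ℂ 3 (periodsT3 F K) c₀ W₂) (T : Finset (PBond (F.P K) 0)) (hT : ∀ w ∈ box z R, ∀ μ : Fin (F.P K).d, (⟨transl c w, μ⟩ : PBond (F.P K) 0) ∈ T) :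
    c₀ * ∑ w ∈ box z R, ∑ μ, (if w + unitVec μ ∈ box z R then ∑ j : Fin 2, ∑ k : Fin 2, ‖((toL2 F K c₀).symm y ⟨transl c w, μ⟩) j k‖ ^ 2 else 0)
      ≤ c₀ * ∑ e ∈ T, ∑ j : Fin 2, ∑ k : Fin 2, ‖((toL2 F K c₀).symm y e) j k‖ ^ 2 := by
  have hc₀ : 0 < c₀ := Fact.out
  exact mul_le_mul_of_nonneg_left (sum_box_ite_frob_le_sum_on c hRN (fun e => (toL2 F K c₀).symm y e) T hT) hc₀.le

/-- ★ **… and over all bonds it is at most `‖y‖²`** (✓`norm_toL2_sq`, ✓`norm_sq_frobEquiv_symm`). [cite: Balaban1985BackgroundPropagators, (3.11) p.392] -/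
theorem box_massF_le_norm_sq (c : Site (F.P K) 0) {z : Zd (F.P K).d} {R : ℤ} (hRN : 2 * R + 1 ≤ ((F.P K).sitesPerDir 0 : ℤ))
    (y : BondL2K ℂ 3 (periodsT3 F K) c₀ W₂) :
    c₀ * ∑ w ∈ box z R, ∑ μ, (if w + unitVec μ ∈ box z R then ∑ j : Fin 2, ∑ k : Fin 2, ‖((toL2 F K c₀).symm y ⟨transl c w, μ⟩) j k‖ ^ 2 else 0)
      ≤ ‖y‖ ^ 2 := by
  have h := box_massF_le_sum_on F K c₀ c (z := z) hRN y Finset.univ (fun w _ μ => Finset.mem_univ _)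
  have hn : ‖y‖ ^ 2 = c₀ * ∑ e : PBond (F.P K) 0, ∑ j : Fin 2, ∑ k : Fin 2, ‖((toL2 F K c₀).symm y e) j k‖ ^ 2 := by
    conv_lhs => rw [← LinearEquiv.apply_symm_apply (toL2 F K c₀) y]
    rw [norm_toL2_sq]
    simp only [norm_sq_frobEquiv_symm]
  rw [hn]; exact h

end Member

end Summit.QuantumFields.YangMills.Theorems.Prop7BoxLocalResidualCurlReading

end
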